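import Summits.AnomalousDissipation.AnomalousDissipation.Theses.BaireTransfer
import Literature.Analysis.FluidPDE.LongTimeAveragePeriodic
import Literature.Analysis.FluidPDE.TorusClassicalLerayHopfProofs
import Literature.Analysis.FunctionSpaces.TorusFluidGlueProofs
import Literature.Analysis.FunctionSpaces.TorusCalculusProofs
import Literature.Analysis.FunctionSpaces.TorusFourierCalculus
import Literature.Analysis.FunctionSpaces.TorusTrigPoly
import Literature.Analysis.FluidPDE.LerayProjectorTorusProofs
import Literature.Analysis.FluidPDE.NSGalerkinFourier

/-!
# Negative knowledge for the crux `DenseLoudDesignerForces` (stmt-AnomalousDissipation-1143), I: kill shape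

Certified copy of §0–§2 of the cdisprove work file `Cruxes/DenseLoudDesignerForces/Disproof.lean`
(refuter-cdisprove, generation 2): the designer force `f_c`, the loud sets `LOUD_j(S,E,ε)` and windows of the
crux, the crux unfolded through them (`Iff.rfl`), the EXACT SHAPE OF A REFUTATION in Baire–Osgood form
(`not_denseLoudDesignerForces_iff` — kill criterion K1 of route BaireTransfer made formal), and the
monotonicity of the loud sets in the level and in the budgets.  Supports stmt-AnomalousDissipation-1143;
nothing here closes an item.
-/

noncomputable section

namespace Summit.AnomalousDissipation.AnomalousDissipation.Theorems.DenseLoudDesignerForces.Negative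

open scoped BigOperators Topology ENNReal InnerProductSpace
open Filter Set MeasureTheory UnitAddTorus
open Literature.Analysis.FunctionSpaces Literature.Analysis.FluidPDE
open Summit.AnomalousDissipation.AnomalousDissipation.Theses.BaireTransfer

/-! ## §0 The objects of the crux -/

/-- The steady trigonometric-polynomial DESIGNER FORCE `f_c = realTrigPoly S (k ↦ P_k ĉ_k)` attached to a
coefficient vector `c ∈ P_S = (↥S → (EuclideanSpace ℂ (Fin 3)))` (verbatim the force term of the crux). -/
def force (S : Finset (Fin 3 → ℤ)) (c : ↥S → (EuclideanSpace ℂ (Fin 3))) : (UnitAddTorus (Fin 3)) → (EuclideanSpace ℝ (Fin 3)) :=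
  Torus.realTrigPoly S (fun k => Torus.lerayCoeff k (Torus.coeffExt S c k))

/-- The LOUD SET `LOUD_j(S,E,ε)`: coefficient vectors carrying, at SOME viscosity `ν ∈ (0, 1/(j+1))`, a
`τ`-periodic classical NS solution forced by `f_c` with mean energy `≤ E` and mean dissipation `≥ ε`
(verbatim the set-builder of the crux). -/
def loudSet (S : Finset (Fin 3 → ℤ)) (E ε : ℝ) (j : ℕ) : Set (↥S → (EuclideanSpace ℂ (Fin 3))) :=
  {c : ↥S → (EuclideanSpace ℂ (Fin 3)) | ∃ ν : ℝ, 0 < ν ∧ ν < 1 / ((j : ℝ) + 1) ∧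
    ∃ (τ : ℝ) (u : ℝ → (UnitAddTorus (Fin 3)) → (EuclideanSpace ℝ (Fin 3))) (p : ℝ → (UnitAddTorus (Fin 3)) → ℝ), 0 < τ ∧
      Torus.IsClassicalNSSolutionOn Set.univ ν (fun _ => force S c) u p ∧
      Function.Periodic u τ ∧ meanEnergy u ≤ E ∧ ε ≤ meanDissipation ν u}

/-- A WINDOW of the crux: an open non-empty `U ⊆ P_S` in which every level's loud set is dense. -/
def IsWindow (S : Finset (Fin 3 → ℤ)) (E ε : ℝ) (U : Set (↥S → (EuclideanSpace ℂ (Fin 3)))) : Prop :=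
  IsOpen U ∧ U.Nonempty ∧ ∀ j : ℕ, U ⊆ closure (loudSet S E ε j)

/-- The crux, unfolded through `loudSet`/`force` (definitional). -/
theorem denseLoudDesignerForces_iff :
    DenseLoudDesignerForces ↔
      ∀ S₀ : Finset (Fin 3 → ℤ), ∃ S : Finset (Fin 3 → ℤ), S₀ ⊆ S ∧ ∃ (E ε : ℝ), 0 < ε ∧
        ∃ U : Set (↥S → (EuclideanSpace ℂ (Fin 3))), IsWindow S E ε U :=
  Iff.rfl

/-! ## §1 Exact shape of a kill (Baire–Osgood form) -/

/-- KILL SHAPE.  `¬ DenseLoudDesignerForces` iff there is a finite stock `S₀` such that for every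
`S ⊇ S₀`, all budgets `E`, `ε > 0` and every open non-empty `U ⊆ P_S`, some level `j` has a non-empty
open `V ⊆ U` DISJOINT from `LOUD_j(S,E,ε)` ("quiet-or-fragile open sets are dense at some level").
This is kill criterion K1 of the route file made formal: a refutation must be a UNIFORM local-quietness
result valid for all large frequency stocks. -/
theorem not_denseLoudDesignerForces_iff :
    ¬ DenseLoudDesignerForces ↔
      ∃ S₀ : Finset (Fin 3 → ℤ), ∀ S : Finset (Fin 3 → ℤ), S₀ ⊆ S → ∀ (E ε : ℝ), 0 < ε →
        ∀ U : Set (↥S → (EuclideanSpace ℂ (Fin 3))), IsOpen U → U.Nonempty →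
          ∃ j : ℕ, ∃ V : Set (↥S → (EuclideanSpace ℂ (Fin 3))), IsOpen V ∧ V.Nonempty ∧ V ⊆ U ∧ Disjoint V (loudSet S E ε j) := by
  rw [denseLoudDesignerForces_iff]
  constructor
  · intro h
    push Not at h
    obtain ⟨S₀, hS₀⟩ := h
    refine ⟨S₀, fun S hS E ε hε U hU hUne => ?_⟩
    have hW : ¬ IsWindow S E ε U := hS₀ S hS E ε hε U
    unfold IsWindow at hW
    push Not at hW
    obtain ⟨j, hj⟩ := hW hU hUne
    rw [Set.not_subset] at hj
    obtain ⟨c, hcU, hc⟩ := hj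
    rw [mem_closure_iff] at hc
    push Not at hc
    obtain ⟨V, hV, hcV, hVd⟩ := hc
    refine ⟨j, V ∩ U, hV.inter hU, ⟨c, hcV, hcU⟩, inter_subset_right, ?_⟩
    rw [Set.disjoint_iff_inter_eq_empty]
    rw [← Set.subset_empty_iff, ← hVd] 
    · exact fun x hx => ⟨hx.1.1, hx.2⟩
  · rintro ⟨S₀, h⟩ hD
    obtain ⟨S, hS, E, ε, hε, U, hU, hUne, hW⟩ := hD S₀
    obtain ⟨j, V, hV, ⟨c, hcV⟩, hVU, hdisj⟩ := h S hS E ε hε U hU hUne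
    have hc : c ∈ closure (loudSet S E ε j) := hW j (hVU hcV)
    rw [mem_closure_iff] at hc
    obtain ⟨x, hxV, hxL⟩ := hc V hV hcV
    exact Set.disjoint_left.1 hdisj hxV hxL

/-! ## §2 Monotonicity: only small viscosities matter -/

/-- `LOUD_{j'} ⊆ LOUD_j` for `j ≤ j'` (the viscosity window shrinks). -/
theorem loudSet_antitone (S : Finset (Fin 3 → ℤ)) (E ε : ℝ) : Antitone (loudSet S E ε) := by
  intro j j' hjj' c hc
  obtain ⟨ν, hν, hνj, rest⟩ := hc
  refine ⟨ν, hν, lt_of_lt_of_le hνj ?_, rest⟩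
  have h1 : (0 : ℝ) < (j : ℝ) + 1 := by positivity
  exact one_div_le_one_div_of_le h1 (by exact_mod_cast Nat.add_le_add_right hjj' 1)

/-- The loud sets grow with the energy budget and shrink with the dissipation floor. -/
theorem loudSet_mono_budgets (S : Finset (Fin 3 → ℤ)) {E E' ε ε' : ℝ} (hE : E ≤ E') (hε : ε' ≤ ε)
    (j : ℕ) : loudSet S E ε j ⊆ loudSet S E' ε' j := by
  rintro c ⟨ν, hν, hνj, τ, u, p, hτ, hsol, hper, hEu, hεu⟩
  exact ⟨ν, hν, hνj, τ, u, p, hτ, hsol, hper, hEu.trans hE, hε.trans hεu⟩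

/-- A window for `(E, ε)` is a window for any larger energy budget and smaller dissipation floor. -/
theorem IsWindow.mono {S : Finset (Fin 3 → ℤ)} {E E' ε ε' : ℝ} {U : Set (↥S → (EuclideanSpace ℂ (Fin 3)))}
    (h : IsWindow S E ε U) (hE : E ≤ E') (hε : ε' ≤ ε) : IsWindow S E' ε' U :=
  ⟨h.1, h.2.1, fun j => (h.2.2 j).trans (closure_mono (loudSet_mono_budgets S hE hε j))⟩

/-- It suffices to produce loudness EVENTUALLY in `j`: if `U ⊆ closure LOUD_j` for all `j ≥ j₀` then `U`
is a window (by antitonicity). -/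
theorem isWindow_of_eventually {S : Finset (Fin 3 → ℤ)} {E ε : ℝ} {U : Set (↥S → (EuclideanSpace ℂ (Fin 3)))} (hU : IsOpen U)
    (hne : U.Nonempty) {j₀ : ℕ} (h : ∀ j, j₀ ≤ j → U ⊆ closure (loudSet S E ε j)) : IsWindow S E ε U :=
  ⟨hU, hne, fun j => (h (max j j₀) (le_max_right _ _)).trans
    (closure_mono (loudSet_antitone S E ε (le_max_left _ _)))⟩

end Summit.AnomalousDissipation.AnomalousDissipation.Theorems.DenseLoudDesignerForces.Negative

end
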